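import Summits.ResolutionOfSingularities.ResolutionOfSingularities.Theorems.WeightedInvariantHypersurfaceCentreAssemblyTorusBound
import Summits.ResolutionOfSingularities.ResolutionOfSingularities.Theorems.WeightedInvariantHypersurfaceCentreAssemblyPullback
import HarnessLib

/-!
# Door assembly H2c″ — [S6] TORUS HALF, ring package: the stalk of `B₊` off the centre is a torus stalk

Route `ResolutionOfSingularities/WeightedInvariant`, crux `Theses.WeightedInvariant.HypersurfaceCentreConstruction`
(stmt-ResolutionOfSingularities-19897), door line `local-engine`, assembly stub **[S6]** `stub_iotaMax_lt_of_step`; plan of record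
`D/res-D-brk-1/S6-PLAN.md` (res-L1-w43-stub-9), TORUS CASE («057: torus half GO»).  After the chart reduction (K4 / K4-E) the
local ring of the successor `B₊` at a point `y′` over `y ∈ U` is `O′ = (extReesAlgebra I′)_{𝔫′}` over `S = Γ(Y,U)_𝔮 ≅ 𝒪_{Y,y}`,
with `I′ₙ = 𝒥ₙ(U)·S` the stalk filtration of the centre and `t⁻¹/1`, `f₀/1` the images of `t⁻¹` and of the local equation
`f₀`; the stalk ideal of the strict transform is the saturation `⋃ₙ ((f₀/1) : (t⁻¹/1)ⁿ)`.  OFF the centre (`y ∉ maxLocus`) the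
filtration is TRIVIAL, `I′ₙ = ⊤`, and this file computes everything in that case, for a regular local `S`, any `f₀ ∈ S`, and
any prime `𝔫′` of `extReesAlgebra I′` lying over `𝔪_S`:

* `extReesAlgebra_eq_top_of_forall_eq_top` — `extReesAlgebra ⊤ = S[T;T⁻¹]` (it contains `t = 1·t¹` and `t⁻¹`);
* `isUnit_tInv_of_forall_eq_top` — `t⁻¹` is a unit there; `iSup_colon_singleton_pow_eq_of_isUnit` — saturating by a unit does
  nothing, so the strict transform's stalk ideal is `(f₀/1)`;
* `exists_ringEquiv_localization_laurent_of_forall_eq_top` — `O′ ≃ (S[T;T⁻¹])_𝔔` for a prime `𝔔` over `𝔪_S`, `f₀/1 ↦ f₀/1`;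
* `iota_localization_laurent_le_of_isLocalRing` — the LOCAL form of the torus-stalk bound p506232;
  `iota_localization_extRees_top_le` — with (c6)+(c10): `ι(O′, f₀/1) ≤ ι(S, f₀)`;
* `mem_sq_of_algebraMap_extRees_top_mem_sq` — `f₀/1 ∈ 𝔪_{O′}ⁿ ↔ f₀ ∈ 𝔪_Sⁿ` ((6b), p508815);
* `iota_le_of_span_eq_saturation_of_forall_eq_top`, `mem_pow_of_span_eq_saturation_of_forall_eq_top` — the same two facts for ANY
  generator `γ` of the saturation `⋃ₙ ((f₀/1) : (t⁻¹/1)ⁿ)` (associates of `f₀/1`), i.e. exactly the data the K4-E read-off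
  delivers (`iotaAt_eq_of_map_ringEquiv`, `mem_maximalIdeal_sq_of_mem_singImage`, p509387).

The scheme-level torus half (`y′ ∈ singImage X′` over `y ∉ maxLocus ι X` ⇒ `iotaAt ι X′ y′ < iotaMax ι X`) is this package +
res-type-089's K4-E stalk chain + `iotaAt_lt_iotaMax_of_not_mem_maxLocus` (p504597).  The clauses are HYPOTHESES on an arbitrary
`ι`; nothing about Hironaka's problem is claimed.  AI-written; weaker than expert review.
-/

noncomputable section

set_option linter.dupNamespace false -- mandated namespace of this single-conjunct summit

open IsLocalRing Polynomial
open scoped LaurentPolynomial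
open Literature.AlgebraicGeometry.Resolution
open Summit.ResolutionOfSingularities.ResolutionOfSingularities.Theorems

namespace Summit.ResolutionOfSingularities.ResolutionOfSingularities.Cruxes.HypersurfaceCentreConstruction.LocalEngine

/-! ## The extended Rees algebra of the trivial filtration is the whole Laurent ring -/

section Top

variable {S : Type} [CommRing S] {I : ℕ → Ideal S}

/-- For the trivial filtration (`Iₙ = ⊤` for all `n`), `t = 1·t¹` lies in the extended Rees algebra. [folklore] -/
theorem T_one_mem_extReesAlgebra_of_forall_eq_top (hI : ∀ n, I n = ⊤) :
    (LaurentPolynomial.T 1 : S[T;T⁻¹]) ∈ extReesAlgebra I := by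
  have h := extReesAlgebra.C_mul_T_mem I (n := 1) Nat.one_pos (a := (1 : S)) (by rw [hI 1]; exact Submodule.mem_top)
  simpa using h

/-- Every Laurent monomial `tⁿ` lies in the extended Rees algebra of the trivial filtration. [folklore] -/
theorem T_mem_extReesAlgebra_of_forall_eq_top (hI : ∀ n, I n = ⊤) (n : ℤ) :
    (LaurentPolynomial.T n : S[T;T⁻¹]) ∈ extReesAlgebra I := by
  have hT1 := T_one_mem_extReesAlgebra_of_forall_eq_top hI
  have hTm1 : (LaurentPolynomial.T (-1) : S[T;T⁻¹]) ∈ extReesAlgebra I := (extReesAlgebra.tInv I).2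
  rcases Int.eq_nat_or_neg n with ⟨m, rfl | rfl⟩
  · have : (LaurentPolynomial.T (m : ℤ) : S[T;T⁻¹]) = LaurentPolynomial.T 1 ^ m := by
      rw [LaurentPolynomial.T_pow, mul_one]
    rw [this]
    exact Subalgebra.pow_mem _ hT1 m
  · have : (LaurentPolynomial.T (-(m : ℤ)) : S[T;T⁻¹]) = LaurentPolynomial.T (-1) ^ m := by
      rw [LaurentPolynomial.T_pow, mul_neg, mul_one]
    rw [this]
    exact Subalgebra.pow_mem _ hTm1 m

/-- **`extReesAlgebra ⊤ = S[T;T⁻¹]`**: the extended Rees algebra of the trivial filtration is the whole Laurent polynomial ring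
(an `S`-subalgebra containing every `tⁿ`). [folklore] -/
theorem extReesAlgebra_eq_top_of_forall_eq_top (hI : ∀ n, I n = ⊤) : extReesAlgebra I = ⊤ := by
  refine top_le_iff.mp fun p _ => ?_
  induction p using LaurentPolynomial.induction_on' with
  | add p q hp hq => exact Subalgebra.add_mem _ (hp Algebra.mem_top) (hq Algebra.mem_top)
  | C_mul_T n a =>
    refine Subalgebra.mul_mem _ ?_ (T_mem_extReesAlgebra_of_forall_eq_top hI n)
    rw [LaurentPolynomial.C_eq_algebraMap]
    exact Subalgebra.algebraMap_mem _ a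

/-- **`t⁻¹` is a unit** in the extended Rees algebra of the trivial filtration (`t⁻¹ · t = 1`). [folklore] -/
theorem isUnit_tInv_of_forall_eq_top (hI : ∀ n, I n = ⊤) : IsUnit (extReesAlgebra.tInv I) := by
  refine isUnit_iff_exists_inv.mpr ⟨⟨LaurentPolynomial.T 1, T_one_mem_extReesAlgebra_of_forall_eq_top hI⟩, ?_⟩
  apply Subtype.ext
  change LaurentPolynomial.T (-1) * LaurentPolynomial.T 1 = (1 : S[T;T⁻¹])
  rw [← LaurentPolynomial.T_add, neg_add_cancel, LaurentPolynomial.T_zero]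

/-- Hence `t⁻¹` lies in no prime of that algebra. [folklore] -/
theorem tInv_not_mem_of_forall_eq_top (hI : ∀ n, I n = ⊤) (𝔫 : Ideal (extReesAlgebra I)) [𝔫.IsPrime] :
    extReesAlgebra.tInv I ∉ 𝔫 :=
  fun h => Ideal.IsPrime.ne_top ‹_› (Ideal.eq_top_of_isUnit_mem _ h (isUnit_tInv_of_forall_eq_top hI))

end Top

/-! ## Saturating by a unit does nothing -/

section Saturation

variable {O : Type} [CommRing O]

/-- `⋃ₙ (J : uⁿ) = J` for a unit `u`. [folklore] -/
theorem iSup_colon_singleton_pow_eq_of_isUnit (J : Ideal O) {u : O} (hu : IsUnit u) :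
    (⨆ n : ℕ, J.colon {u ^ n}) = J := by
  ext x
  rw [mem_iSup_ideal_colon_singleton_pow_iff]
  constructor
  · rintro ⟨n, hn⟩
    exact (Ideal.unit_mul_mem_iff_mem J (hu.pow n)).mp hn
  · intro hx
    exact ⟨0, by simpa using hx⟩

/-- If `(γ) = ⋃ₙ ((a) : uⁿ)` for a unit `u`, then `(γ) = (a)`. [folklore] -/
theorem span_eq_span_of_span_eq_iSup_colon_of_isUnit {a γ u : O} (hu : IsUnit u)
    (hγ : Ideal.span {γ} = ⨆ n : ℕ, (Ideal.span {a}).colon {u ^ n}) : Ideal.span {γ} = Ideal.span {a} := by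
  rw [hγ, iSup_colon_singleton_pow_eq_of_isUnit _ hu]

end Saturation

/-! ## The localised trivial extended Rees algebra is a torus stalk -/

section Stalk

variable {S : Type} [CommRing S] {I : ℕ → Ideal S}

/-- **`(extReesAlgebra ⊤)_{𝔫′} ≃ (S[T;T⁻¹])_𝔔`** for a prime `𝔔` (the image of `𝔫′`), compatibly with the structure maps from
`S`; if `𝔫′` lies over an ideal `𝔪` of `S` then so does `𝔔`. [folklore] -/
theorem exists_ringEquiv_localization_laurent_of_forall_eq_top (hI : ∀ n, I n = ⊤)
    (𝔫 : Ideal (extReesAlgebra I)) [𝔫.IsPrime] :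
    ∃ (𝔔 : Ideal S[T;T⁻¹]) (_ : 𝔔.IsPrime),
      𝔔.comap (algebraMap S S[T;T⁻¹]) = 𝔫.comap (algebraMap S (extReesAlgebra I)) ∧
      ∃ Θ : Localization.AtPrime 𝔫 ≃+* Localization.AtPrime 𝔔,
        ∀ f : S, Θ (algebraMap S (Localization.AtPrime 𝔫) f) = algebraMap S (Localization.AtPrime 𝔔) f := by
  -- `extReesAlgebra ⊤ ≃ S[T;T⁻¹]` as `S`-algebras
  let e : extReesAlgebra I ≃ₐ[S] S[T;T⁻¹] :=
    (Subalgebra.equivOfEq _ _ (extReesAlgebra_eq_top_of_forall_eq_top hI)).trans Subalgebra.topEquiv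
  let 𝔔 : Ideal S[T;T⁻¹] := 𝔫.comap e.symm.toRingEquiv.toRingHom
  haveI h𝔔 : 𝔔.IsPrime := Ideal.IsPrime.comap _
  have hmap : 𝔫.primeCompl.map e.toRingEquiv.toMonoidHom = 𝔔.primeCompl := by
    ext x
    simp only [Submonoid.mem_map, Ideal.mem_primeCompl_iff]
    constructor
    · rintro ⟨y, hy, rfl⟩
      change ¬ e.symm.toRingEquiv.toRingHom (e.toRingEquiv.toMonoidHom y) ∈ 𝔫
      simpa using hy
    · intro hx
      refine ⟨e.symm x, ?_, by simp⟩
      exact hx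
  refine ⟨𝔔, h𝔔, ?_,
    IsLocalization.ringEquivOfRingEquiv (Localization.AtPrime 𝔫) (Localization.AtPrime 𝔔) e.toRingEquiv hmap,
    fun f => ?_⟩
  · have hcomp : e.symm.toRingEquiv.toRingHom.comp (algebraMap S S[T;T⁻¹]) = algebraMap S (extReesAlgebra I) :=
      RingHom.ext fun s => e.symm.commutes s
    change (𝔫.comap e.symm.toRingEquiv.toRingHom).comap (algebraMap S S[T;T⁻¹]) = _
    rw [Ideal.comap_comap, hcomp]
  · rw [IsScalarTower.algebraMap_apply S (extReesAlgebra I) (Localization.AtPrime 𝔫),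
      IsLocalization.ringEquivOfRingEquiv_eq]
    change algebraMap S[T;T⁻¹] (Localization.AtPrime 𝔔) (e (algebraMap S (extReesAlgebra I) f)) = _
    rw [e.commutes f, ← IsScalarTower.algebraMap_apply]

variable (ι : (R : Type) → [CommRing R] → R → Ordinal.{0})

/-- **Local form of the torus-stalk bound** (p506232 at `𝔭 = 𝔪_S`): `S` regular local, `𝔔` a prime of `S[T;T⁻¹]` over
`𝔪_S`: `ι((S[T;T⁻¹])_𝔔, f) ≤ ι(S, f)`. [folklore] -/
theorem iota_localization_laurent_le_of_isLocalRing [IsRegularLocalRing S] (hc6 : IotaIsoInvariant ι)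
    (hc10 : IotaTorusFactorMonotone ι) (f : S) (𝔔 : Ideal S[T;T⁻¹]) [𝔔.IsPrime]
    (h𝔔 : 𝔔.comap (algebraMap S S[T;T⁻¹]) = maximalIdeal S) :
    ι (Localization.AtPrime 𝔔) (algebraMap S (Localization.AtPrime 𝔔) f) ≤ ι S f := by
  let e₀ : S ≃ₐ[S] Localization.AtPrime (maximalIdeal S) :=
    IsLocalization.atUnits S (maximalIdeal S).primeCompl (S := Localization.AtPrime (maximalIdeal S))
      (fun x hx => (IsLocalRing.notMem_maximalIdeal.mp hx))
  haveI : IsRegularLocalRing (Localization.AtPrime (maximalIdeal S)) :=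
    @IsRegularLocalRing.of_ringEquiv S _ ‹_› _ _ e₀.toRingEquiv
  have h := iota_localization_laurent_le ι hc6 hc10 (maximalIdeal S) f 𝔔 h𝔔
  have he₀ : algebraMap S (Localization.AtPrime (maximalIdeal S)) f = e₀.toRingEquiv f := by
    change _ = e₀ f
    simp
  rw [he₀, hc6 _ _ e₀.toRingEquiv f] at h
  exact h

/-- **TORUS CASE, the `ι`-bound**: `S` regular local, `I = ⊤` the trivial filtration, `𝔫′` a prime of `extReesAlgebra I` over
`𝔪_S`, `f₀ ∈ S`; for `ι` with (c6) and (c10): `ι((extReesAlgebra I)_{𝔫′}, f₀/1) ≤ ι(S, f₀)`. [folklore] -/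
theorem iota_localization_extRees_top_le [IsRegularLocalRing S] (hc6 : IotaIsoInvariant ι)
    (hc10 : IotaTorusFactorMonotone ι) (hI : ∀ n, I n = ⊤) (𝔫 : Ideal (extReesAlgebra I)) [𝔫.IsPrime]
    (h𝔫 : 𝔫.comap (algebraMap S (extReesAlgebra I)) = maximalIdeal S) (f₀ : S) :
    ι (Localization.AtPrime 𝔫) (algebraMap S (Localization.AtPrime 𝔫) f₀) ≤ ι S f₀ := by
  obtain ⟨𝔔, h𝔔, hcomap, Θ, hΘ⟩ := exists_ringEquiv_localization_laurent_of_forall_eq_top hI 𝔫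
  rw [h𝔫] at hcomap
  rw [← hc6 _ _ Θ, hΘ f₀]
  exact iota_localization_laurent_le_of_isLocalRing ι hc6 hc10 f₀ 𝔔 hcomap

/-- **TORUS CASE, the `𝔪`-adic filtration**: with the same data, `f₀/1 ∈ 𝔪((extReesAlgebra I)_{𝔫′})ⁿ ↔ f₀ ∈ 𝔪_Sⁿ` ((6b) p508815
transported along `Θ`). [folklore] -/
theorem algebraMap_extRees_top_mem_pow_iff [IsRegularLocalRing S] (hI : ∀ n, I n = ⊤) (𝔫 : Ideal (extReesAlgebra I))
    [𝔫.IsPrime] (h𝔫 : 𝔫.comap (algebraMap S (extReesAlgebra I)) = maximalIdeal S) (f₀ : S) (n : ℕ) :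
    algebraMap S (Localization.AtPrime 𝔫) f₀ ∈ maximalIdeal (Localization.AtPrime 𝔫) ^ n ↔ f₀ ∈ maximalIdeal S ^ n := by
  obtain ⟨𝔔, h𝔔, hcomap, Θ, hΘ⟩ := exists_ringEquiv_localization_laurent_of_forall_eq_top hI 𝔫
  rw [h𝔫] at hcomap
  rw [mem_pow_maximalIdeal_iff_map_ringEquiv (R := Localization.AtPrime 𝔫) (R' := Localization.AtPrime 𝔔) Θ, hΘ f₀,
    mem_pow_maximalIdeal_iff_laurent_of_isLocalRing 𝔔 hcomap f₀ n]

/-- (6b) torus form: `f₀/1 ∈ 𝔪²` at the torus stalk forces `f₀ ∈ 𝔪_S²`. [folklore] -/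
theorem mem_sq_of_algebraMap_extRees_top_mem_sq [IsRegularLocalRing S] (hI : ∀ n, I n = ⊤)
    (𝔫 : Ideal (extReesAlgebra I)) [𝔫.IsPrime] (h𝔫 : 𝔫.comap (algebraMap S (extReesAlgebra I)) = maximalIdeal S)
    {f₀ : S} (h : algebraMap S (Localization.AtPrime 𝔫) f₀ ∈ maximalIdeal (Localization.AtPrime 𝔫) ^ 2) :
    f₀ ∈ maximalIdeal S ^ 2 :=
  (algebraMap_extRees_top_mem_pow_iff hI 𝔫 h𝔫 f₀ 2).mp h

/-! ### With a generator `γ` of the saturation (the K4-E read-off data) -/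

/-- The localisation of an extended Rees algebra over a domain at a prime is a domain. [folklore] -/
theorem isDomain_localization_extReesAlgebra [IsDomain S] (𝔫 : Ideal (extReesAlgebra I)) [𝔫.IsPrime] :
    IsDomain (Localization.AtPrime 𝔫) :=
  haveI : IsDomain (extReesAlgebra I) := inferInstance
  IsLocalization.isDomain_localization (Ideal.primeCompl_le_nonZeroDivisors 𝔫)

/-- **TORUS CASE with the read-off generator**: if `(γ) = ⋃ₙ ((f₀/1) : (t⁻¹/1)ⁿ)` in `O′ = (extReesAlgebra ⊤)_{𝔫′}` (the stalk of
the strict transform, K4-E (I)), then `ι(O′, γ) ≤ ι(S, f₀)` ((c6), (c10), (c12a)). [folklore] -/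
theorem iota_le_of_span_eq_saturation_of_forall_eq_top [IsRegularLocalRing S] (hc6 : IotaIsoInvariant ι)
    (hc10 : IotaTorusFactorMonotone ι) (hu : IotaUnitInvariant ι) (hI : ∀ n, I n = ⊤)
    (𝔫 : Ideal (extReesAlgebra I)) [𝔫.IsPrime] (h𝔫 : 𝔫.comap (algebraMap S (extReesAlgebra I)) = maximalIdeal S)
    (f₀ : S) {γ : Localization.AtPrime 𝔫}
    (hγ : Ideal.span {γ} = ⨆ n : ℕ, (Ideal.span {algebraMap S (Localization.AtPrime 𝔫) f₀}).colon
      {algebraMap (extReesAlgebra I) (Localization.AtPrime 𝔫) (extReesAlgebra.tInv I) ^ n}) :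
    ι (Localization.AtPrime 𝔫) γ ≤ ι S f₀ := by
  haveI : IsDomain S := isDomain_of_isRegularLocalRing S
  haveI : IsDomain (Localization.AtPrime 𝔫) := isDomain_localization_extReesAlgebra 𝔫
  have hunit : IsUnit (algebraMap (extReesAlgebra I) (Localization.AtPrime 𝔫) (extReesAlgebra.tInv I)) :=
    (isUnit_tInv_of_forall_eq_top hI).map (algebraMap (extReesAlgebra I) (Localization.AtPrime 𝔫))
  have hspan := span_eq_span_of_span_eq_iSup_colon_of_isUnit (O := Localization.AtPrime 𝔫) hunit hγ
  rw [iota_eq_of_span_singleton_eq ι hu hspan]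
  exact iota_localization_extRees_top_le ι hc6 hc10 hI 𝔫 h𝔫 f₀

/-- **TORUS CASE with the read-off generator, `𝔪²`**: if moreover `γ ∈ 𝔪_{O′}²` (the point of the strict transform is
NON-regular, K4-E read-off) then `f₀ ∈ 𝔪_S²` (the base point is a non-regular point of `V(X)`). [folklore] -/
theorem mem_sq_of_span_eq_saturation_of_forall_eq_top [IsRegularLocalRing S] (hI : ∀ n, I n = ⊤)
    (𝔫 : Ideal (extReesAlgebra I)) [𝔫.IsPrime] (h𝔫 : 𝔫.comap (algebraMap S (extReesAlgebra I)) = maximalIdeal S)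
    {f₀ : S} {γ : Localization.AtPrime 𝔫}
    (hγ : Ideal.span {γ} = ⨆ n : ℕ, (Ideal.span {algebraMap S (Localization.AtPrime 𝔫) f₀}).colon
      {algebraMap (extReesAlgebra I) (Localization.AtPrime 𝔫) (extReesAlgebra.tInv I) ^ n})
    (hγ2 : γ ∈ maximalIdeal (Localization.AtPrime 𝔫) ^ 2) : f₀ ∈ maximalIdeal S ^ 2 := by
  haveI : IsDomain S := isDomain_of_isRegularLocalRing S
  haveI : IsDomain (Localization.AtPrime 𝔫) := isDomain_localization_extReesAlgebra 𝔫
  have hunit : IsUnit (algebraMap (extReesAlgebra I) (Localization.AtPrime 𝔫) (extReesAlgebra.tInv I)) :=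
    (isUnit_tInv_of_forall_eq_top hI).map (algebraMap (extReesAlgebra I) (Localization.AtPrime 𝔫))
  have hspan := span_eq_span_of_span_eq_iSup_colon_of_isUnit (O := Localization.AtPrime 𝔫) hunit hγ
  -- `γ` and `f₀/1` are associates
  obtain ⟨v, hv⟩ := Ideal.span_singleton_eq_span_singleton.mp hspan
  apply mem_sq_of_algebraMap_extRees_top_mem_sq hI 𝔫 h𝔫
  rw [← hv, mul_comm]
  exact (Ideal.unit_mul_mem_iff_mem _ v.isUnit).mpr hγ2

end Stalk

end Summit.ResolutionOfSingularities.ResolutionOfSingularities.Cruxes.HypersurfaceCentreConstruction.LocalEngine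

end
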